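import Literature.NumberTheory.EllipticCurves.KummerSelmerStructure
import Literature.NumberTheory.GaloisRepresentations.LocalFieldInertiaCdOne
import Literature.NumberTheory.GaloisRepresentations.LocalGlobalCohomologyDualityProofs
import HarnessLib

/-!
# Poitou–Tate duality for finite modules, 1/7 (definitions): annihilators under a perfect `ℤ/n`-pairing and their counting, descent of `2`-cocycles, the trivial module `ℤ/m` versus `μ_m` (re-homed)

**Poitou–Tate duality for finite Galois modules over number fields and its consequences, proved in the tree's vocabulary from the idèle
class formation (Milne, *Arithmetic Duality Theorems* I §2, §4; Tate, ICM 1962; Harari 2020 Ch. 17–18; Serre, Durham 1977 §6): the named facts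
`Literature.NumberTheory.GaloisCohomology.poitouTate_sha_tateDual` (PT (ii): `Ш¹(K, M)` and `Ш¹(K, M^D)` are exact annihilators, `PoitouTateSha.lean`),
`…poitouTate_sha_zmod_mu` (its `ℤ/m` / `μ_m` instance), `…poitouTate_three_realPlaces_injective` (Milne I Thm. 4.10 (c), degree 3,
`PoitouTateRealPlacesHigherDegree.lean`), `…poitouTate_selmerStructure_duality_conj` (duality for Selmer structures with conjugation-compatible
canonical invariants, `PoitouTateSelmerStructuresConj.lean`), `Literature.NumberTheory.GaloisRepresentations.Patrikis2019_exists_lift_projective` / `…_exists_spinLift` /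
`…_exists_spinLift_of_continuous` (Tate's `H²(Γ_K, ℚ/ℤ) = 0` and Patrikis' lifting statements, `ProjectiveLifting.lean`, `TateSpinLift.lean`,
`TateSpinLiftContinuous.lean`) and `Literature.NumberTheory.GaloisCohomology.Howard2004.prop141_casselsTate_skewPairing_atLevel_printIntended` /
`…thm161_dvrKolyvaginBound_printIntended` (Howard 2004 Prop. 1.4.1 / Thm. 1.6.1 as intended, `Howard2004/`) HOLD — EXACT names `<fact>_holds`
(files 2 and 7 of 7).**  Contents: (1, definitions file) annihilators under a perfect `ℤ/n`-valued pairing of finite abelian groups and their counting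
(Milne I §0), descent of `2`-cocycles through an open normal subgroup, the trivial module `ℤ/m` versus `μ_m` (transport maps); (2) `Ш³` and
`H³(K, M) → ⊕_{v real}` injectivity via the Brauer group (`H³(Γ_K, K̄ˣ) = 0`, odd descent, Sylow fields); (3) unramified local conditions,
inertia and the unramified subgroup, local Tate pairing vanishing on unramified classes, exact orthogonality at almost all places, bidual transport,
the all-places reduction, presentation read-out and the reciprocity equality; (4) finiteness of Selmer groups, finite duality of `Ш`-duals, new places,
`Ш²` read-out roads, weak Leopoldt; (5) the real-place corrections, native `Ш²` assembly, presentation pairings, the idèle package and the reciprocity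
sum; (6) local duality at every place, the Selmer-complement reduction, unramified orthogonality at all levels, the all-places reduction, the
middle-exact dual symmetry; (7) `Ш¹`-duality `poitouTate_sha_tateDual_holds`, the `ℤ/m`–`μ_m` instance, `H²`-finite support, Tate's theorem
`H²(Γ_K, ℚ/ℤ) = 0` for every number field and the Patrikis / Howard / Selmer-structure discharges.
RE-HOMED into `Literature/` by the Hodge foundations lane (`lit-hodgefound`, seat p20, generation 40): verbatim DECLARATION-LEVEL ports (the 221
declarations needed, in dependency order; each Part is a slice of one Summits module) of 63 modules
`Summits/BirchSwinnertonDyer/BirchSwinnertonDyer/Theorems/{SchneiderFreeAdditiveX3PoitouTate*,SchneiderFreeAdditiveX3TateH2VanishingAllNumberFields,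
CumulativeHeegnerLeopoldtRedSplitControlAtThreeSha*,ThetaPartnerAtTwoSignedControlAtTwo{MuReal*,ShaTwo*,ShaThree*,GlobalHTwoFiniteSupport},
KolyvaginRoadThreePTDevissageCofinite,PoitouTateSelmerStructureDualityConjHolds,Howard{Thm161PrintIntendedOfProp141Intended,FlachSkewPairingAtLevelIntendedHolds}}.lean`
and `Summits/BirchSwinnertonDyer/Rank1Residual/{X11b,GaloisImage}/*.lean`; the namespaces `Summit.BirchSwinnertonDyer.BirchSwinnertonDyer.Theorems[.SchneiderFreeAdditiveX3]`
and `Summit.BirchSwinnertonDyer.Rank1Residual` are re-rooted at `Literature.NumberTheory.GaloisCohomology.PoitouTateFinite` (sub-namespaces `PoitouTateReduction`,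
`PoitouTateShaTwoReadout`, `PoitouTateShaAnnihilator`, `SignedEC.*`, `KolyvaginRoadThreePT`, `InputsPoitouTateSelmer`, `Howard*`, `GaloisImage.*` kept; the route-item
segment `X11b` is dropped: `…X11b.{FiniteDuality,Levels,LocBridge,H2Support,ShaBound,WeakLeopoldt}` ↦ `PoitouTateFinite.{…}`);
four lemmas of `X11b/MaxUnramifiedRestriction.lean` already in `Literature/NumberTheory/GaloisRepresentations/UnramifiedClassesInertia.lean` are used from
there; the nine `_holds` theorems carry the EXACT names.  Built on the tree's Literature layer (`Literature/NumberTheory/{GaloisRepresentations,GaloisCohomology,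
Automorphic,EllipticCurves}/…`, `Literature/Algebra/Homology/…`, `Literature/AnabelianGeometry/AbsoluteAnabelian/…`).  No new named fact (D-0026); imports
Mathlib/Literature only; every declaration carries the citation of the printed statement it formalises or serves.  The Summits originals stay in
place (transitional duplication).  WHAT THIS IS NOT: nothing here bears on the Birch–Swinnerton-Dyer conjecture or any summit statement; it is
classical Poitou–Tate duality for finite modules (1960s) re-proved in the tree's vocabulary.
-/

noncomputable section

/-!
## Part 1 — port of `Summits/BirchSwinnertonDyer/Rank1Residual/X11b/PerfectPairingAnnihilators.lean` (20 declarations kept)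

# annihilators under a perfect `ℤ/n`-valued pairing of finite groups (the counting behind "exact orthogonal complements")

Declarations of this Part (verbatim port; each keeps its own docstring and citation): `annRight`, `annLeft`, `mem_annRight_iff`, `mem_annLeft_iff`, `annLeft_eq_annRight_flip`, `annRight_eq_annLeft_flip`, `annLeft_anti`, `le_annLeft_annRight`, `annLeft_sup`, `annRight_sup`, `restrictHom`, `restrictHom_apply`, `natCard_ker_restrictHom`, `restrictHom_surjective`, `natCard_eq_of_bijective`, `natCard_annRight_mul`, `flip_flip`, `natCard_annLeft_mul`, `annLeft_annRight`, `annRight_annLeft`.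

Reference keys (see `references.bib` and the declarations' citations): [MilneADT2006].
-/

section Part1

open _root_.Function

namespace Literature.NumberTheory.GaloisCohomology.PoitouTateFinite.FiniteDuality

open Literature.NumberTheory.GaloisRepresentations

variable {A : Type*} [AddCommGroup A] {B : Type*} [AddCommGroup B] {n : ℕ}

/-- The **right annihilator** `A'^⊥ = {y ∈ B | b(x, y) = 0 ∀ x ∈ A'}` of a subgroup `A' ≤ A` under
a bi-additive pairing `b : A × B → ℤ/n`. [cite: MilneADT2006, Ch. I §0 (pairings; dual of a finite group), Prop. 0.19] -/
def annRight (b : A →+ B →+ ZMod n) (A' : AddSubgroup A) : AddSubgroup B where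
  carrier := {y | ∀ x ∈ A', b x y = 0}
  zero_mem' := fun x _ => by simp only [map_zero]
  add_mem' := fun {y y'} hy hy' x hx => by simp only [map_add, hy x hx, hy' x hx, add_zero]
  neg_mem' := fun {y} hy x hx => by simp only [map_neg, hy x hx, neg_zero]

/-- The **left annihilator** `{}^⊥B' = {x ∈ A | b(x, y) = 0 ∀ y ∈ B'}` of a subgroup `B' ≤ B`.
[cite: MilneADT2006, Ch. I §0 (pairings; dual of a finite group), Prop. 0.19] -/
def annLeft (b : A →+ B →+ ZMod n) (B' : AddSubgroup B) : AddSubgroup A where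
  carrier := {x | ∀ y ∈ B', b x y = 0}
  zero_mem' := fun y _ => by simp only [map_zero, AddMonoidHom.zero_apply]
  add_mem' := fun {x x'} hx hx' y hy => by
    simp only [map_add, AddMonoidHom.add_apply, hx y hy, hx' y hy, add_zero]
  neg_mem' := fun {x} hx y hy => by simp only [map_neg, AddMonoidHom.neg_apply, hx y hy, neg_zero]

/-- Membership in the right annihilator. [cite: MilneADT2006, Ch. I §0 (pairings; dual of a finite group), Prop. 0.19] -/
@[simp] theorem mem_annRight_iff (b : A →+ B →+ ZMod n) (A' : AddSubgroup A) (y : B) :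
    y ∈ annRight b A' ↔ ∀ x ∈ A', b x y = 0 := Iff.rfl

/-- Membership in the left annihilator. [cite: MilneADT2006, Ch. I §0 (pairings; dual of a finite group), Prop. 0.19] -/
@[simp] theorem mem_annLeft_iff (b : A →+ B →+ ZMod n) (B' : AddSubgroup B) (x : A) :
    x ∈ annLeft b B' ↔ ∀ y ∈ B', b x y = 0 := Iff.rfl

/-- The left annihilator for `b` is the right annihilator for `b.flip`. [cite: MilneADT2006, Ch. I §0 (pairings; dual of a finite group), Prop. 0.19] -/
theorem annLeft_eq_annRight_flip (b : A →+ B →+ ZMod n) (B' : AddSubgroup B) :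
    annLeft b B' = annRight b.flip B' := by
  ext x; simp only [mem_annLeft_iff, mem_annRight_iff, AddMonoidHom.flip_apply]

/-- The right annihilator for `b` is the left annihilator for `b.flip`. [cite: MilneADT2006, Ch. I §0 (pairings; dual of a finite group), Prop. 0.19] -/
theorem annRight_eq_annLeft_flip (b : A →+ B →+ ZMod n) (A' : AddSubgroup A) :
    annRight b A' = annLeft b.flip A' := by
  ext y; simp only [mem_annLeft_iff, mem_annRight_iff, AddMonoidHom.flip_apply]

/-- Annihilators reverse inclusions. [cite: MilneADT2006, Ch. I §0 (pairings; dual of a finite group), Prop. 0.19] -/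
theorem annLeft_anti (b : A →+ B →+ ZMod n) {B' B'' : AddSubgroup B} (h : B' ≤ B'') :
    annLeft b B'' ≤ annLeft b B' := fun _ hx y hy => hx y (h hy)

/-- `A' ≤ {}^⊥(A'^⊥)`. [cite: MilneADT2006, Ch. I §0 (pairings; dual of a finite group), Prop. 0.19] -/
theorem le_annLeft_annRight (b : A →+ B →+ ZMod n) (A' : AddSubgroup A) :
    A' ≤ annLeft b (annRight b A') := fun _ hx _ hy => hy _ hx

/-- The annihilator of a join is the meet of the annihilators. [cite: MilneADT2006, Ch. I §0 (pairings; dual of a finite group), Prop. 0.19] -/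
theorem annLeft_sup (b : A →+ B →+ ZMod n) (B' B'' : AddSubgroup B) :
    annLeft b (B' ⊔ B'') = annLeft b B' ⊓ annLeft b B'' := by
  refine le_antisymm (le_inf (annLeft_anti b le_sup_left) (annLeft_anti b le_sup_right)) ?_
  rintro x ⟨h', h''⟩ y hy
  obtain ⟨y', hy', y'', hy'', rfl⟩ := AddSubgroup.mem_sup.mp hy
  rw [map_add, h' y' hy', h'' y'' hy'', add_zero]

/-- The annihilator of a join is the meet of the annihilators. [cite: MilneADT2006, Ch. I §0 (pairings; dual of a finite group), Prop. 0.19] -/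
theorem annRight_sup (b : A →+ B →+ ZMod n) (A' A'' : AddSubgroup A) :
    annRight b (A' ⊔ A'') = annRight b A' ⊓ annRight b A'' := by
  rw [annRight_eq_annLeft_flip, annRight_eq_annLeft_flip, annRight_eq_annLeft_flip, annLeft_sup]

/-- Restriction of `ℤ/n`-valued characters to a subgroup, as an additive map
`Hom(A, ℤ/n) →+ Hom(A', ℤ/n)`. [cite: MilneADT2006, Ch. I §0 (pairings; dual of a finite group), Prop. 0.19] -/
def restrictHom (A' : AddSubgroup A) (n : ℕ) : (A →+ ZMod n) →+ (A' →+ ZMod n) where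
  toFun f := f.comp A'.subtype
  map_zero' := rfl
  map_add' _ _ := rfl

/-- Unfolding `restrictHom`. [cite: MilneADT2006, Ch. I §0 (pairings; dual of a finite group), Prop. 0.19] -/
@[simp] theorem restrictHom_apply (A' : AddSubgroup A) (n : ℕ) (f : A →+ ZMod n) (x : A') :
    restrictHom A' n f x = f x := rfl

/-- The kernel of restriction to `A'` is in bijection with `Hom(A/A', ℤ/n)`. [cite: MilneADT2006, Ch. I §0 (pairings; dual of a finite group), Prop. 0.19] -/
theorem natCard_ker_restrictHom (A' : AddSubgroup A) (n : ℕ) :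
    Nat.card (restrictHom A' n).ker = Nat.card (A ⧸ A' →+ ZMod n) := by
  refine Nat.card_congr
    { toFun := fun f => QuotientAddGroup.lift A' f.1 fun x hx => ?_
      invFun := fun g => ⟨g.comp (QuotientAddGroup.mk' A'), ?_⟩
      left_inv := fun f => Subtype.ext (AddMonoidHom.ext fun x => by simp)
      right_inv := fun g => AddMonoidHom.ext fun x => by
        induction x using QuotientAddGroup.induction_on with
        | H a => simp }
  · have hf := f.2
    rw [AddMonoidHom.mem_ker] at hf
    have := DFunLike.congr_fun hf ⟨x, hx⟩
    simpa using this
  · rw [AddMonoidHom.mem_ker]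
    ext x
    simp only [restrictHom_apply, AddMonoidHom.coe_comp, QuotientAddGroup.coe_mk', comp_apply,
      AddMonoidHom.zero_apply, (QuotientAddGroup.eq_zero_iff (x : A)).mpr x.2, map_zero]

/-- **`ℤ/n`-valued characters of a subgroup extend**: for a finite abelian group `A` killed by
`n ≠ 0` and `A' ≤ A`, restriction `Hom(A, ℤ/n) → Hom(A', ℤ/n)` is surjective.  Proof by counting:
`#Hom(A, ℤ/n) = #A`, the kernel is `Hom(A/A', ℤ/n)` of order `#(A/A')`, so the image has order
`#A / #(A/A') = #A' = #Hom(A', ℤ/n)`.  (Milne, *ADT* I Prop. 0.19: `M ↦ M^*` is exact on finite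
groups.) [cite: MilneADT2006, Ch. I §0 (pairings; dual of a finite group), Prop. 0.19] -/
theorem restrictHom_surjective [Finite A] [NeZero n] (hA : ∀ a : A, n • a = 0)
    (A' : AddSubgroup A) : Surjective (restrictHom A' n) := by
  haveI := finite_addMonoidHom_zmod A n
  haveI := finite_addMonoidHom_zmod A' n
  have hA' : ∀ a : A', n • a = 0 := fun a => Subtype.ext (by simpa using hA a)
  have hQ : ∀ q : A ⧸ A', n • q = 0 := fun q => by
    induction q using QuotientAddGroup.induction_on with
    | H a => rw [← QuotientAddGroup.mk_nsmul, hA a, QuotientAddGroup.mk_zero]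
  -- `#Hom(A) = #ker · #range`, `#ker = #(A/A')`, `#Hom(A) = #A = #(A/A') · #A'`
  have h1 : Nat.card (restrictHom A' n).ker * Nat.card (restrictHom A' n).range =
      Nat.card (A →+ ZMod n) := by
    rw [← AddSubgroup.index_ker, AddSubgroup.card_mul_index]
  rw [natCard_ker_restrictHom, Nat.card_addMonoidHom_zmod hQ, Nat.card_addMonoidHom_zmod hA,
    ← AddSubgroup.index_eq_card, ← AddSubgroup.card_mul_index A', mul_comm] at h1
  have hidx : A'.index ≠ 0 := AddSubgroup.index_ne_zero_of_finite
  have hrange : Nat.card (restrictHom A' n).range = Nat.card (A' →+ ZMod n) := by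
    rw [Nat.card_addMonoidHom_zmod hA']
    exact mul_right_cancel₀ hidx h1
  exact AddMonoidHom.range_eq_top.mp (AddSubgroup.eq_top_of_card_eq _ hrange)

section Perfect

/-- **`#A = #B`** when the adjoint `A → Hom(B, ℤ/n)` is bijective and `n · B = 0`
(`#Hom(B, ℤ/n) = #B`). [cite: MilneADT2006, Ch. I §0 (pairings; dual of a finite group), Prop. 0.19] -/
theorem natCard_eq_of_bijective [Finite B] [NeZero n] (hB : ∀ y : B, n • y = 0) (b : A →+ B →+ ZMod n)
    (hb : Bijective b) : Nat.card A = Nat.card B := by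
  haveI := finite_addMonoidHom_zmod B n
  rw [Nat.card_congr (Equiv.ofBijective b hb), Nat.card_addMonoidHom_zmod hB]

/-- **`#A'^⊥ · #A' = #B`**: for `n · A = 0` and the adjoint `B → Hom(A, ℤ/n)` bijective, the right
annihilator of `A' ≤ A` has index `#A'` in `B` — it is the kernel of the surjection
`B ≅ Hom(A, ℤ/n) ↠ Hom(A', ℤ/n)` (`restrictHom_surjective`).  Milne, *ADT* I §0 (exactness of
`M ↦ M^*` on finite groups). [cite: MilneADT2006, Ch. I §0 (pairings; dual of a finite group), Prop. 0.19] -/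
theorem natCard_annRight_mul [Finite A] [NeZero n] (hA : ∀ x : A, n • x = 0) (b : A →+ B →+ ZMod n)
    (hflip : Bijective b.flip) (A' : AddSubgroup A) :
    Nat.card (annRight b A') * Nat.card A' = Nat.card B := by
  set φ : B →+ (A' →+ ZMod n) := (restrictHom A' n).comp b.flip with hφ
  have hsurj : Surjective φ := (restrictHom_surjective hA A').comp hflip.2
  have hker : φ.ker = annRight b A' := by
    ext y
    simp only [AddMonoidHom.mem_ker, mem_annRight_iff, hφ]
    constructor
    · intro h x hx
      have := DFunLike.congr_fun h ⟨x, hx⟩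
      simpa using this
    · intro h
      ext x
      simpa using h x x.2
  have hA' : ∀ a : A', n • a = 0 := fun a => Subtype.ext (by simpa using hA a)
  haveI := finite_addMonoidHom_zmod A' n
  have h := AddSubgroup.card_mul_index φ.ker
  rw [AddSubgroup.index_ker, AddMonoidHom.range_eq_top.mpr hsurj, AddSubgroup.card_top,
    Nat.card_addMonoidHom_zmod hA', hker] at h
  exact h

/-- `b.flip.flip = b`. [cite: MilneADT2006, Ch. I §0 (pairings; dual of a finite group), Prop. 0.19] -/
theorem flip_flip (b : A →+ B →+ ZMod n) : b.flip.flip = b := by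
  ext; rfl

/-- **`#{}^⊥B' · #B' = #A`** (the left-handed version of `natCard_annRight_mul`: `n · B = 0` and the
adjoint `A → Hom(B, ℤ/n)` bijective). [cite: MilneADT2006, Ch. I §0 (pairings; dual of a finite group), Prop. 0.19] -/
theorem natCard_annLeft_mul [Finite B] [NeZero n] (hB : ∀ y : B, n • y = 0) (b : A →+ B →+ ZMod n)
    (hb : Bijective b) (B' : AddSubgroup B) :
    Nat.card (annLeft b B') * Nat.card B' = Nat.card A := by
  rw [annLeft_eq_annRight_flip]
  exact natCard_annRight_mul hB b.flip (by rw [flip_flip]; exact hb) B'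

/-- **Double annihilator `{}^⊥(A'^⊥) = A'`** for a perfect pairing (both adjoints bijective) of finite
groups killed by `n`: `A' ≤ {}^⊥(A'^⊥)` always, and both have order `#A / #A'^⊥`
(`#A = #B`).  Milne, *ADT* I Prop. 0.19 (`M** = M` for finite `M`). [cite: MilneADT2006, Ch. I §0 (pairings; dual of a finite group), Prop. 0.19] -/
theorem annLeft_annRight [Finite A] [Finite B] [NeZero n] (hA : ∀ x : A, n • x = 0) (hB : ∀ y : B, n • y = 0)
    (b : A →+ B →+ ZMod n) (hb : Bijective b) (hflip : Bijective b.flip) (A' : AddSubgroup A) :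
    annLeft b (annRight b A') = A' := by
  symm
  refine AddSubgroup.eq_of_le_of_card_ge (le_annLeft_annRight b A') (le_of_eq ?_)
  have h1 := natCard_annLeft_mul hB b hb (annRight b A')
  have h2 := natCard_annRight_mul hA b hflip A'
  have h3 := natCard_eq_of_bijective hB b hb
  have hpos : 0 < Nat.card (annRight b A') := Nat.card_pos
  refine Nat.eq_of_mul_eq_mul_right hpos ?_
  rw [h1, h3, ← h2, mul_comm]

/-- **Double annihilator `({}^⊥B')^⊥ = B'`** (right-handed version). [cite: MilneADT2006, Ch. I §0 (pairings; dual of a finite group), Prop. 0.19] -/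
theorem annRight_annLeft [Finite A] [Finite B] [NeZero n] (hA : ∀ x : A, n • x = 0) (hB : ∀ y : B, n • y = 0)
    (b : A →+ B →+ ZMod n) (hb : Bijective b) (hflip : Bijective b.flip) (B' : AddSubgroup B) :
    annRight b (annLeft b B') = B' := by
  rw [annRight_eq_annLeft_flip, annLeft_eq_annRight_flip]
  exact annLeft_annRight hB hA b.flip hflip (by rw [flip_flip]; exact hb) B'

end Perfect

end Literature.NumberTheory.GaloisCohomology.PoitouTateFinite.FiniteDuality

end Part1

/-!
## Part 2 — port of `Summits/BirchSwinnertonDyer/Rank1Residual/X11b/AnticyclotomicLevelStructure.lean` (1 declarations kept)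

# Naturality of localisation in degree `1`: `loc_v (H¹(f) c) = H¹(f|_{Γ_{K_v}}) (loc_v c)`

Declarations of this Part (verbatim port; each keeps its own docstring and citation): `localization_map_one`.

Reference keys (see `references.bib` and the declarations' citations): [SerreGaloisCohomology1997].
-/

section Part2

open scoped _root_.Classical

open _root_.CategoryTheory _root_.NumberField _root_.IsDedekindDomain _root_.Field
open Literature.NumberTheory.EllipticCurves
open Literature.NumberTheory.GaloisRepresentations
open Literature.NumberTheory.GaloisRepresentations.DiscreteGaloisModule (SelmerStructure)
open scoped ContRepresentation

universe u

namespace Literature.NumberTheory.GaloisCohomology.PoitouTateFinite.Levels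

section Comap

variable {K : Type u} [Field K] [NumberField K] {A B : Type u} [AddCommGroup A]
  [TopologicalSpace A] [DiscreteTopology A] [AddCommGroup B] [TopologicalSpace B]
  [DiscreteTopology B] {ρ : DiscreteGaloisModule K A} {ρ' : DiscreteGaloisModule K B}

/-- Naturality of localisation: `loc_v (H¹(f) c) = H¹(f|_{Γ_{K_v}}) (loc_v c)` (the tree's
`galoisCohomology.res_map_one` read at `Place.Completion v`). [cite: SerreGaloisCohomology1997, Ch. I §2.4 (functoriality of cohomology in the pair (group, module))] -/
theorem localization_map_one (f : ρ.toContRepresentation →ⁱL ρ'.toContRepresentation)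
    (v : Place K) (c : galoisCohomology ρ 1) :
    galoisCohomology.localization ρ' v 1 (galoisCohomology.map f 1 c) =
      galoisCohomology.map (f.restrictField (Place.Completion v)) 1
        (galoisCohomology.localization ρ v 1 c) :=
  galoisCohomology.res_map_one (Place.Completion v) f c

end Comap

end Literature.NumberTheory.GaloisCohomology.PoitouTateFinite.Levels

end Part2

/-!
## Part 3 — port of `Summits/BirchSwinnertonDyer/Rank1Residual/X11b/GlobalH2FiniteSupport.lean` (2 declarations kept)

# Descent of a bi-invariant `2`-cocycle of `Γ_F` to the unramified quotient `Γ_F ⧸ Gal(F̄/F^nr)` (local field `F`)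

Declarations of this Part (verbatim port; each keeps its own docstring and citation): `mem_invariantsOf_galUnr`, `descendTwoCocycle`.

Reference keys (see `references.bib` and the declarations' citations): [SerreGaloisCohomology1997].
-/

section Part3

open scoped _root_.Classical

open _root_.CategoryTheory _root_.Field _root_.NumberField _root_.IsDedekindDomain _root_.Topology
open Literature.NumberTheory.EllipticCurves
open Literature.NumberTheory.GaloisRepresentations
open scoped ContRepresentation

universe u

-- `H²` needs `LocallyCompactSpace Γ`; compactness of absolute Galois groups as a local instance.
attribute [local instance] absoluteGaloisGroup_compactSpace

namespace Literature.NumberTheory.GaloisCohomology.PoitouTateFinite.H2Support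

section Local

variable (F : Type u) [Field F] [ValuativeRel F] [TopologicalSpace F] [IsNonarchimedeanLocalField F]
variable {B : Type u} [AddCommGroup B] [TopologicalSpace B] [DiscreteTopology B]
  (τ : ContinuousRep (absoluteGaloisGroup F) ℤ B)

omit [DiscreteTopology B] in
/-- Every element of `B` is invariant under `N = Gal(F̄/F^nr)` when an overgroup `U ⊇ I_F = N` acts
trivially. [cite: SerreGaloisCohomology1997, Ch. I §2.4 (functoriality of cohomology in the pair (group, module))] -/
theorem mem_invariantsOf_galUnr (U : Subgroup (absoluteGaloisGroup F)) (hIU : absInertia F ≤ U)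
    (hUB : ∀ u ∈ U, ∀ b : B, τ u b = b) (b : B) : b ∈ τ.invariantsOf (galUnr F) := by
  rw [ContinuousRep.mem_invariantsOf_iff]
  intro n
  exact hUB _ (hIU (by rw [← galUnr_eq_absInertia]; exact n.2)) b

variable {F τ}

/-- **Descent of a bi-invariant `2`-cocycle to the unramified quotient** `Q = Γ_F ⧸ Gal(F̄/F^nr)`,
with values in `B^N = B` for the quotient module `τ.quotientInvariants N`: the function
`(x, y) ↦ z(x̃, ỹ)` on representatives (well defined by bi-invariance under `U ⊇ N`, continuous
because `Γ_F × Γ_F → Q × Q` is an open quotient map). [cite: SerreGaloisCohomology1997, Ch. I §2.4 (functoriality of cohomology in the pair (group, module))] -/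
def descendTwoCocycle (U : Subgroup (absoluteGaloisGroup F)) (hIU : absInertia F ≤ U)
    (hUB : ∀ u ∈ U, ∀ b : B, τ u b = b) (z : contTwoCocycles τ.toTopRep)
    (hz : ∀ σ ρ, ∀ u₁ ∈ U, ∀ u₂ ∈ U, z.1 (σ * u₁, ρ * u₂) = z.1 (σ, ρ)) :
    contTwoCocycles (τ.quotientInvariants (galUnr F)).toTopRep := by
  -- the descended function on representatives
  let N := galUnr F
  have hNU : N ≤ U := fun n hn ↦ hIU (by rw [← galUnr_eq_absInertia]; exact hn)
  let g : (absoluteGaloisGroup F ⧸ N) → (absoluteGaloisGroup F ⧸ N) → τ.invariantsOf N :=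
    fun x y ↦ ⟨z.1 (Quotient.out x, Quotient.out y), mem_invariantsOf_galUnr F τ U hIU hUB _⟩
  have hg : ∀ σ ρ : absoluteGaloisGroup F,
      g (QuotientGroup.mk σ) (QuotientGroup.mk ρ) = ⟨z.1 (σ, ρ), mem_invariantsOf_galUnr F τ U hIU hUB _⟩ := by
    intro σ ρ
    obtain ⟨n₁, hn₁⟩ := QuotientGroup.mk_out_eq_mul N σ
    obtain ⟨n₂, hn₂⟩ := QuotientGroup.mk_out_eq_mul N ρ
    apply Subtype.ext
    change z.1 (Quotient.out (QuotientGroup.mk σ : absoluteGaloisGroup F ⧸ N),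
      Quotient.out (QuotientGroup.mk ρ : absoluteGaloisGroup F ⧸ N)) = z.1 (σ, ρ)
    rw [hn₁, hn₂]
    exact hz σ ρ n₁ (hNU n₁.2) n₂ (hNU n₂.2)
  -- continuity
  have hcont : Continuous (Function.uncurry g) := by
    have hq : IsOpenQuotientMap (Prod.map (QuotientGroup.mk : absoluteGaloisGroup F → _ ⧸ N)
        (QuotientGroup.mk : absoluteGaloisGroup F → _ ⧸ N)) :=
      QuotientGroup.isOpenQuotientMap_mk.prodMap QuotientGroup.isOpenQuotientMap_mk
    rw [← hq.continuous_comp_iff]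
    have e : Function.uncurry g ∘ Prod.map QuotientGroup.mk QuotientGroup.mk =
        fun στ : absoluteGaloisGroup F × absoluteGaloisGroup F ↦
          (⟨z.1 στ, mem_invariantsOf_galUnr F τ U hIU hUB _⟩ : τ.invariantsOf N) := by
      funext στ
      exact hg στ.1 στ.2
    rw [e]
    exact z.1.continuous.subtype_mk _
  refine ⟨⟨Function.uncurry g, hcont⟩, fun x y w ↦ ?_⟩
  obtain ⟨σ, rfl⟩ := QuotientGroup.mk_surjective x
  obtain ⟨ρ, rfl⟩ := QuotientGroup.mk_surjective y
  obtain ⟨υ, rfl⟩ := QuotientGroup.mk_surjective w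
  change (τ.quotientInvariants N) (QuotientGroup.mk σ) (g (QuotientGroup.mk ρ) (QuotientGroup.mk υ)) +
      g (QuotientGroup.mk σ) (QuotientGroup.mk ρ * QuotientGroup.mk υ) =
    g (QuotientGroup.mk σ * QuotientGroup.mk ρ) (QuotientGroup.mk υ) +
      g (QuotientGroup.mk σ) (QuotientGroup.mk ρ)
  rw [← QuotientGroup.mk_mul, ← QuotientGroup.mk_mul, hg, hg, hg, hg]
  apply Subtype.ext
  change τ σ (z.1 (ρ, υ)) + z.1 (σ, ρ * υ) = z.1 (σ * ρ, υ) + z.1 (σ, ρ)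
  exact z.2 σ ρ υ

end Local

end Literature.NumberTheory.GaloisCohomology.PoitouTateFinite.H2Support

end Part3

/-!
## Part 4 — port of `Summits/BirchSwinnertonDyer/BirchSwinnertonDyer/Theorems/SchneiderFreeAdditiveX3PoitouTateShaZModMuHolds.lean` (17 declarations kept)

# The trivial module `ℤ/m` versus `μ_m`: `Hom(ℤ/m, μ_m) ≅ μ_m` (`evalOne`, `ofMu`), transport of `Ш¹` along an isomorphism (`shaCongr`), `Ш¹(K, (ℤ/m)^D) ≃ Ш¹(K, μ_m)`

Declarations of this Part (verbatim port; each keeps its own docstring and citation): `trivZMod`, `nsmul_muCarrier_eq_zero`, `evalOneHom`, `evalOneHom_apply`, `ofMuFun`, `ofMuFun_intCast`, `ofMuHom`, `ofMuHom_apply_intCast`, `evalOneHom_ofMuHom`, `ofMuHom_evalOneHom`, `evalOne`, `ofMu`, `map_one_mem_sha`, `map_one_map_one_eq_self`, `shaCongr`, `pairingCongrRight`, `shaTateDualTrivEquiv`.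

Reference keys (see `references.bib` and the declarations' citations): [MilneADT2006], [SerreGaloisCohomology1997].
-/

section Part4

namespace Literature.NumberTheory.GaloisCohomology.PoitouTateFinite.PoitouTateReduction

open Literature.NumberTheory.GaloisRepresentations Literature.NumberTheory.GaloisCohomology
open Literature.NumberTheory.GaloisRepresentations.DiscreteGaloisModule
open _root_.Field _root_.Function _root_.NumberField
open scoped ContRepresentation

section Transport

variable (K : Type) [Field K] (m : ℕ)

/-- The trivial discrete `Γ_K`-module `ℤ/m`. [cite: MilneADT2006, Ch. I §4, Thm. 4.10 (with M = ℤ/m, M^D = μ_m)] -/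
abbrev trivZMod : DiscreteGaloisModule K (ZMod m) :=
  ContinuousRep.trivial (absoluteGaloisGroup K) ℤ (ZMod m)

/-- `μ_m` is killed by `m`. [cite: MilneADT2006, Ch. I §4, Thm. 4.10 (with M = ℤ/m, M^D = μ_m)] -/
theorem nsmul_muCarrier_eq_zero (ζ : MuCarrier K m) : m • ζ = 0 := by
  apply muVal_injective K m
  rw [muVal_nsmul, muVal_pow_eq_one, muVal_zero]

/-- Evaluation at `1 : ℤ/m`, `Hom(ℤ/m, μ_m) → μ_m`, as an additive map. [cite: MilneADT2006, Ch. I §4, Thm. 4.10 (with M = ℤ/m, M^D = μ_m)] -/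
def evalOneHom : TateDual K (ZMod m) m →+ MuCarrier K m where
  toFun f := MuCarrier.toAdditive.symm (f 1)
  map_zero' := by simp
  map_add' f g := by simp

/-- Unfolding `evalOneHom`. [cite: MilneADT2006, Ch. I §4, Thm. 4.10 (with M = ℤ/m, M^D = μ_m)] -/
@[simp] theorem evalOneHom_apply (f : TateDual K (ZMod m) m) :
    evalOneHom K m f = MuCarrier.toAdditive.symm (f 1) := rfl

/-- The additive map `ℤ/m → μ_m`, `k ↦ k • ζ`, attached to `ζ ∈ μ_m` (through `ZMod.lift`). [cite: MilneADT2006, Ch. I §4, Thm. 4.10 (with M = ℤ/m, M^D = μ_m)] -/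
def ofMuFun (ζ : MuCarrier K m) : ZMod m →+ Additive (rootsOfUnity m (AlgebraicClosure K)) :=
  ZMod.lift m ⟨zmultiplesHom _ (MuCarrier.toAdditive ζ), by
    change ((m : ℕ) : ℤ) • MuCarrier.toAdditive ζ = 0
    rw [natCast_zsmul, ← map_nsmul, nsmul_muCarrier_eq_zero, map_zero]⟩

/-- `ofMuFun ζ` on the class of an integer `z` is `z • ζ`. [cite: MilneADT2006, Ch. I §4, Thm. 4.10 (with M = ℤ/m, M^D = μ_m)] -/
theorem ofMuFun_intCast (ζ : MuCarrier K m) (z : ℤ) :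
    ofMuFun K m ζ (z : ZMod m) = z • MuCarrier.toAdditive ζ := by
  rw [ofMuFun, ZMod.lift_coe]
  simp

/-- The inverse: `ζ ↦ (k ↦ k • ζ)`, `μ_m → Hom(ℤ/m, μ_m)`. [cite: MilneADT2006, Ch. I §4, Thm. 4.10 (with M = ℤ/m, M^D = μ_m)] -/
def ofMuHom : MuCarrier K m →+ TateDual K (ZMod m) m where
  toFun ζ := (ofMuFun K m ζ : ZMod m →+ Additive (rootsOfUnity m (AlgebraicClosure K)))
  map_zero' := by
    refine TateDual.ext fun k => ?_
    obtain ⟨z, rfl⟩ := ZMod.intCast_surjective k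
    change ofMuFun K m 0 (z : ZMod m) = 0
    rw [ofMuFun_intCast, map_zero, zsmul_zero]
  map_add' ζ ζ' := by
    refine TateDual.ext fun k => ?_
    obtain ⟨z, rfl⟩ := ZMod.intCast_surjective k
    change ofMuFun K m (ζ + ζ') (z : ZMod m) = ofMuFun K m ζ (z : ZMod m) + ofMuFun K m ζ' (z : ZMod m)
    rw [ofMuFun_intCast, ofMuFun_intCast, ofMuFun_intCast, map_add, zsmul_add]

/-- `ofMuHom ζ` on the class of an integer `z` is `z • ζ`. [cite: MilneADT2006, Ch. I §4, Thm. 4.10 (with M = ℤ/m, M^D = μ_m)] -/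
theorem ofMuHom_apply_intCast (ζ : MuCarrier K m) (z : ℤ) :
    ofMuHom K m ζ (z : ZMod m) = z • MuCarrier.toAdditive ζ := by
  change ofMuFun K m ζ (z : ZMod m) = _
  rw [ofMuFun_intCast]

/-- `(k ↦ k • ζ) 1 = ζ`. [cite: MilneADT2006, Ch. I §4, Thm. 4.10 (with M = ℤ/m, M^D = μ_m)] -/
theorem evalOneHom_ofMuHom (ζ : MuCarrier K m) : evalOneHom K m (ofMuHom K m ζ) = ζ := by
  rw [evalOneHom_apply]
  have h := ofMuHom_apply_intCast K m ζ 1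
  rw [Int.cast_one, one_zsmul] at h
  rw [h]
  rfl

/-- `k ↦ k • f 1` is `f`, for an additive `f : ℤ/m → μ_m`. [cite: MilneADT2006, Ch. I §4, Thm. 4.10 (with M = ℤ/m, M^D = μ_m)] -/
theorem ofMuHom_evalOneHom (f : TateDual K (ZMod m) m) : ofMuHom K m (evalOneHom K m f) = f := by
  refine TateDual.ext fun k => ?_
  obtain ⟨z, rfl⟩ := ZMod.intCast_surjective k
  rw [ofMuHom_apply_intCast, evalOneHom_apply]
  change z • f 1 = f (z : ZMod m)
  rw [← map_zsmul (f : ZMod m →+ Additive (rootsOfUnity m (AlgebraicClosure K))) z 1, zsmul_one]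

variable [NeZero m]

/-- **`(ℤ/m)^D = Hom(ℤ/m, μ_m) → μ_m`, `f ↦ f 1`, is `Γ_K`-equivariant** (for the Tate-dual action
`(σ f)(k) = σ (f (σ⁻¹ k)) = σ (f k)` of the trivial module). [cite: MilneADT2006, Ch. I §4, Thm. 4.10 (with M = ℤ/m, M^D = μ_m)] -/
def evalOne : ((trivZMod K m).tateDual m).toContRepresentation →ⁱL (mu K m).toContRepresentation where
  toContinuousLinearMap := ⟨(evalOneHom K m).toIntLinearMap, continuous_of_discreteTopology⟩
  isIntertwining' σ := by
    refine ContinuousLinearMap.ext fun f => ?_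
    apply MuCarrier.toAdditive.injective
    simp only [ContinuousLinearMap.coe_comp, ContinuousLinearMap.coe_mk', Function.comp_apply,
      ContinuousRep.toContRepresentation_apply_apply, AddMonoidHom.coe_toIntLinearMap, evalOneHom_apply,
      tateDual_apply_apply_apply, ContinuousRep.trivial_apply, AddEquiv.apply_symm_apply]
    rfl

/-- The inverse equivariant map `μ_m → (ℤ/m)^D`, `ζ ↦ (k ↦ k • ζ)`. [cite: MilneADT2006, Ch. I §4, Thm. 4.10 (with M = ℤ/m, M^D = μ_m)] -/
def ofMu : (mu K m).toContRepresentation →ⁱL ((trivZMod K m).tateDual m).toContRepresentation where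
  toContinuousLinearMap := ⟨(ofMuHom K m).toIntLinearMap, continuous_of_discreteTopology⟩
  isIntertwining' σ := by
    refine ContinuousLinearMap.ext fun ζ => ?_
    change ofMuHom K m (mu K m σ ζ) = (trivZMod K m).tateDual m σ (ofMuHom K m ζ)
    refine TateDual.ext fun k => ?_
    obtain ⟨z, rfl⟩ := ZMod.intCast_surjective k
    rw [tateDual_apply_apply_apply, ofMuHom_apply_intCast]
    change _ = mu K m σ (ofMuHom K m ζ ((trivZMod K m) σ⁻¹ (z : ZMod m)))
    rw [ContinuousRep.trivial_apply, ofMuHom_apply_intCast]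
    change z • MuCarrier.toAdditive (mu K m σ ζ) = MuCarrier.toAdditive (mu K m σ (MuCarrier.toAdditive.symm (z • MuCarrier.toAdditive ζ)))
    rw [← map_zsmul, ← map_zsmul]
    rfl

end Transport

section ShaMap

variable {K : Type} [Field K] [NumberField K]
variable {M N : Type} [AddCommGroup M] [TopologicalSpace M] [DiscreteTopology M]
  [AddCommGroup N] [TopologicalSpace N] [DiscreteTopology N]
  {ρ : DiscreteGaloisModule K M} {ρ' : DiscreteGaloisModule K N}

/-- **`H¹(f)` maps `Ш¹(K, M)` into `Ш¹(K, N)`** for every continuous equivariant `f : M → N`. [cite: MilneADT2006, Ch. I §4] -/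
theorem map_one_mem_sha (f : ρ.toContRepresentation →ⁱL ρ'.toContRepresentation) {c : galoisCohomology ρ 1}
    (hc : c ∈ sha ρ) : galoisCohomology.map f 1 c ∈ sha ρ' := by
  rw [mem_sha_iff] at hc ⊢
  intro v
  rw [Literature.NumberTheory.GaloisCohomology.PoitouTateFinite.Levels.localization_map_one, hc v]
  exact map_zero _

omit [NumberField K] in
/-- **`H¹(g) ∘ H¹(f) = id` when `g ∘ f = id`** (on classes of continuous crossed homomorphisms).
[cite: SerreGaloisCohomology1997, I §2.2] -/
theorem map_one_map_one_eq_self (f : ρ.toContRepresentation →ⁱL ρ'.toContRepresentation)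
    (g : ρ'.toContRepresentation →ⁱL ρ.toContRepresentation) (hgf : ∀ x : M, g (f x) = x)
    (c : galoisCohomology ρ 1) : galoisCohomology.map g 1 (galoisCohomology.map f 1 c) = c := by
  obtain ⟨φ, rfl⟩ := oneCocycleClass_surjective _ c
  rw [galoisCohomology.map_one_oneCocycleClass, galoisCohomology.map_one_oneCocycleClass]
  exact congrArg (oneCocycleClass _) (Subtype.ext (ContinuousMap.ext fun σ => hgf (φ.1 σ)))

/-- **`Ш¹` along a pair of mutually inverse equivariant maps**: `H¹(f)` restricts to an additive isomorphism
`Ш¹(K, M) ≃+ Ш¹(K, N)` with inverse `H¹(g)`. [cite: MilneADT2006, Ch. I §4] -/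
def shaCongr (f : ρ.toContRepresentation →ⁱL ρ'.toContRepresentation)
    (g : ρ'.toContRepresentation →ⁱL ρ.toContRepresentation) (hgf : ∀ x : M, g (f x) = x)
    (hfg : ∀ y : N, f (g y) = y) : sha ρ ≃+ sha ρ' where
  toFun c := ⟨galoisCohomology.map f 1 c, map_one_mem_sha f c.2⟩
  invFun d := ⟨galoisCohomology.map g 1 d, map_one_mem_sha g d.2⟩
  left_inv c := Subtype.ext (map_one_map_one_eq_self f g hgf c)
  right_inv d := Subtype.ext (map_one_map_one_eq_self g f hfg d)
  map_add' _ _ := Subtype.ext (map_add _ _ _)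

end ShaMap

section Pairing

variable {A B B' C : Type*} [AddCommGroup A] [AddCommGroup B] [AddCommGroup B'] [AddCommGroup C]

/-- Re-index the second argument of a bi-additive pairing along `e : B ≃+ B'`: `b' a y = b a (e⁻¹ y)`. [cite: MilneADT2006, Ch. I §4, Thm. 4.10 (with M = ℤ/m, M^D = μ_m)] -/
def pairingCongrRight (b : A →+ B →+ C) (e : B ≃+ B') : A →+ B' →+ C :=
  (e.addMonoidHomCongrLeft (N := C)).toAddMonoidHom.comp b

end Pairing

section Holds

/-- `Ш¹(K, (ℤ/m)^D) ≃+ Ш¹(K, μ_m)` along `f ↦ f 1`. [cite: MilneADT2006, Ch. I §4] -/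
def shaTateDualTrivEquiv (K : Type) [Field K] [NumberField K] (m : ℕ) [NeZero m] :
    sha ((trivZMod K m).tateDual m) ≃+ sha (mu K m) :=
  shaCongr (evalOne K m) (ofMu K m) (ofMuHom_evalOneHom K m) (evalOneHom_ofMuHom K m)

end Holds

end Literature.NumberTheory.GaloisCohomology.PoitouTateFinite.PoitouTateReduction

end Part4

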